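import Mathlib
import HarnessLib
import HarnessLib.Audit
import Summits.Parity.Statement
import Literature.Barriers.Parity.SiegelZeroDichotomy
import Literature.NumberTheory.Sieve.LinearEquationsInPrimesCrudeBounds

/-!
Route: ParityLineCarving

DORMANT since 2026-09-04T14:29:50Z (reconciler: no traction for 5 d (last activity statement-checked at 2026-08-30T13:44:23Z); parked, not closed — `ledger route dormant route-Parity-ParityLineCarving --off` to reactivate) — unstaffed, not closed; items shared with open routes are served there. `ledger route dormant <id> --off` reactivates.

# Route ParityLineCarving — GHL ⟸ bounded Siegel quality ∧ the parity-line upper envelope ∧ the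
diluted Chen lower envelope ∧ the two Q-conditioned parity lifts

decomp-parity (D-0178/D-0179) lens-6 g3 node «ParityLineCarving» (RESIDUAL mode), an OR-ALTERNATIVE
beneath Q at the record route's
residual pair UQ = stmt-Parity-25149 ∧ LQ = stmt-Parity-25150 of route-Parity-SiegelSpectrumSplit (Q
= stmt-Parity-25148, text verbatim).
Carving axis = the PARITY LINE: for each one-sided half of GHL the largest piece that is necessary,
by construction outside every
catalogued parity barrier's hypotheses (it asks of the primes only what level-1 Type-I information
certifies) and immune to exceptional
characters; the complements (lifts) carry all parity content and, Q-conditioned, sit formally below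
UQ / LQ. It suffices to show
X = Q ∧ UpperParityLine ∧ UpperParityLiftQ ∧ LowerDilutedChen ∧ LowerDilutionLiftQ: Q = bounded
Siegel-zero quality (record leaf);
UpperParityLine = every non-degenerate Green–Tao system obeys S ≤ 2^(t−1)·|β_∞∏β_p| + εN^d (uniform
block); LowerDilutedChen = with
every form but the first relaxed from Λ to Λ + ½·log N·1[Ω = 2], the main term never exceeds the
diluted sum by more than εN^d;
the lifts = piece → (Q → bare half). Kernel (HOME/decomp-parity-lens-6/g3/ParityLineCarving.lean):
closes with 5/5 binders, necessity
of every piece from GHL, node_iff, and record_iff_pieces : (Q ∧ UQ ∧ LQ) ⟺ X unconditionally.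
Lean: `(∃ η₀ : ℝ, ∃ q₀ : ℕ, ∀ (q : ℕ) [NeZero q] (χ : DirichletCharacter ℂ q) (η : ℝ), q₀ ≤ q →
Literature.Barriers.Parity.IsSiegelZero χ η → η < η₀) ∧ (∀ (d t L : ℕ), 1 ≤ d → 1 ≤ t → ∀ ε : ℝ, 0 <
ε → ∃ N₀ : ℕ, ∀ N : ℕ, N₀ ≤ N → ∀ Ψ : Fin t → Literature.NumberTheory.Sieve.AffLinForm d,
Literature.NumberTheory.Sieve.IsNondegenerateSystem Ψ → Literature.NumberTheory.Sieve.affLinSize Ψ N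
≤ L → ∀ K : Set (Fin d → ℝ), Convex ℝ K → K ⊆ Literature.NumberTheory.Sieve.realBox d N →
Literature.NumberTheory.Sieve.vonMangoldtSum Ψ K N ≤ (2 : ℝ) ^ (t - 1) *
|Literature.NumberTheory.Sieve.archFactor Ψ K * Literature.NumberTheory.Sieve.singularProduct Ψ| + ε
* (N : ℝ) ^ d) ∧ ((∀ (d t L : ℕ), 1 ≤ d → 1 ≤ t → ∀ ε : ℝ, 0 < ε → ∃ N₀ : ℕ, ∀ N : ℕ, N₀ ≤ N → ∀ Ψ :
Fin t → Literature.NumberTheory.Sieve.AffLinForm d,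
Literature.NumberTheory.Sieve.IsNondegenerateSystem Ψ → Literature.NumberTheory.Sieve.affLinSize Ψ N
≤ L → ∀ K : Set (Fin d → ℝ), Convex ℝ K → K ⊆ Literature.NumberTheory.Sieve.realBox d N →
Literature.NumberTheory.Sieve.vonMangoldtSum Ψ K N ≤ (2 : ℝ) ^ (t - 1) *
|Literature.NumberTheory.Sieve.archFactor Ψ K * Literature.NumberTheory.Sieve.singularProduct Ψ| + ε
* (N : ℝ) ^ d) → (∃ η₀ : ℝ, ∃ q₀ : ℕ, ∀ (q : ℕ) [NeZero q] (χ : DirichletCharacter ℂ q) (η : ℝ), q₀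
≤ q → Literature.Barriers.Parity.IsSiegelZero χ η → η < η₀) → ∀ (d t L : ℕ), 1 ≤ d → 1 ≤ t → ∀ ε :
ℝ, 0 < ε → ∃ N₀ : ℕ, ∀ N : ℕ, N₀ ≤ N → ∀ Ψ : Fin t → Literature.NumberTheory.Sieve.AffLinForm d,
Literature.NumberTheory.Sieve.IsNondegenerateSystem Ψ → Literature.NumberTheory.Sieve.affLinSize Ψ N
≤ L → ∀ K : Set (Fin d → ℝ), Convex ℝ K → K ⊆ Literature.NumberTheory.Sieve.realBox d N →
Literature.NumberTheory.Sieve.vonMangoldtSum Ψ K N - Literature.NumberTheory.Sieve.archFactor Ψ K *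
Literature.NumberTheory.Sieve.singularProduct Ψ ≤ ε * (N : ℝ) ^ d) ∧ (∀ (d t L : ℕ), 1 ≤ d → 1 ≤ t →
∀ ε : ℝ, 0 < ε → ∃ N₀ : ℕ, ∀ N : ℕ, N₀ ≤ N → ∀ Ψ : Fin t → Literature.NumberTheory.Sieve.AffLinForm
d, Literature.NumberTheory.Sieve.IsNondegenerateSystem Ψ → Literature.NumberTheory.Sieve.affLinSize
Ψ N ≤ L → ∀ K : Set (Fin d → ℝ), Convex ℝ K → K ⊆ Literature.NumberTheory.Sieve.realBox d N →
Literature.NumberTheory.Sieve.archFactor Ψ K * Literature.NumberTheory.Sieve.singularProduct Ψ - (∑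
n ∈ Literature.NumberTheory.Sieve.latticeBox d N, K.indicator (fun _ => (1 : ℝ))
(Literature.NumberTheory.Sieve.realPoint n) * ∏ i : Fin t,
(Literature.NumberTheory.Sieve.intVonMangoldt ((Ψ i).eval n) + (if (i : ℕ) = 0 then (0 : ℝ) else (1
/ 2 : ℝ) * (if ArithmeticFunction.cardFactors (((Ψ i).eval n).toNat) = 2 then Real.log (N : ℝ) else
0)))) ≤ ε * (N : ℝ) ^ d) ∧ ((∀ (d t L : ℕ), 1 ≤ d → 1 ≤ t → ∀ ε : ℝ, 0 < ε → ∃ N₀ : ℕ, ∀ N : ℕ, N₀ ≤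
N → ∀ Ψ : Fin t → Literature.NumberTheory.Sieve.AffLinForm d,
Literature.NumberTheory.Sieve.IsNondegenerateSystem Ψ → Literature.NumberTheory.Sieve.affLinSize Ψ N
≤ L → ∀ K : Set (Fin d → ℝ), Convex ℝ K → K ⊆ Literature.NumberTheory.Sieve.realBox d N →
Literature.NumberTheory.Sieve.archFactor Ψ K * Literature.NumberTheory.Sieve.singularProduct Ψ - (∑
n ∈ Literature.NumberTheory.Sieve.latticeBox d N, K.indicator (fun _ => (1 : ℝ))
(Literature.NumberTheory.Sieve.realPoint n) * ∏ i : Fin t,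
(Literature.NumberTheory.Sieve.intVonMangoldt ((Ψ i).eval n) + (if (i : ℕ) = 0 then (0 : ℝ) else (1
/ 2 : ℝ) * (if ArithmeticFunction.cardFactors (((Ψ i).eval n).toNat) = 2 then Real.log (N : ℝ) else
0)))) ≤ ε * (N : ℝ) ^ d) → (∃ η₀ : ℝ, ∃ q₀ : ℕ, ∀ (q : ℕ) [NeZero q] (χ : DirichletCharacter ℂ q) (η
: ℝ), q₀ ≤ q → Literature.Barriers.Parity.IsSiegelZero χ η → η < η₀) → ∀ (d t L : ℕ), 1 ≤ d → 1 ≤ t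
→ ∀ ε : ℝ, 0 < ε → ∃ N₀ : ℕ, ∀ N : ℕ, N₀ ≤ N → ∀ Ψ : Fin t →
Literature.NumberTheory.Sieve.AffLinForm d, Literature.NumberTheory.Sieve.IsNondegenerateSystem Ψ →
Literature.NumberTheory.Sieve.affLinSize Ψ N ≤ L → ∀ K : Set (Fin d → ℝ), Convex ℝ K → K ⊆
Literature.NumberTheory.Sieve.realBox d N → Literature.NumberTheory.Sieve.archFactor Ψ K *
Literature.NumberTheory.Sieve.singularProduct Ψ - Literature.NumberTheory.Sieve.vonMangoldtSum Ψ K N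
≤ ε * (N : ℝ) ^ d)`

## Assembly
Pure logic plus |a − b| ≤ c ⟺ (a − b ≤ c ∧ b − a ≤ c): hLu hAu hQ is the bare upper half, hLl hAl hQ
the bare lower half, and the two
one-sided halves with N₀ := max give GHL (`closes` in glue.lean; kernel `closes`, `ghl_iff_halves`).
Every binder is consumed (Q feeds both
lifts, each lift consumes its piece). Exactness: node_iff (mod the record's by-name necessity of Q)
and record_iff_pieces unconditionally.

Rationale: WHY THIS LINE. The parity barriers (Selberg1949, Bombieri1976, Greaves2001 Thm 4.5.1: F and f are
attained by Selberg's sets) say exactly how far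
Type-I information reaches: upper bounds with constant 2 per sifted prime condition, Λ₂-asymptotics
but no Λ-asymptotics (Bombieri's
asymptotic sieve, k = 2 versus k = 1). Cutting each half of GHL AT that line makes the accessible
part a load-bearing binder instead of a
rung: the upper envelope with the law C(t) = 2^(t−1) — the exact supremum of the bias in any
single-parity-bit world (Bombieri models,
λ = χ_exceptional: MatomakiMerikoski2023 Thm 1.3 gives factor 2 at h = 2q) and
⊠-supermultiplicative, so the tensor-power collapse of
uniform constants (critic T10) does not apply (kernel §6) — and, on the lower side, where the
natural notch η = 1 «prime + P₂ pairs reach the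
HL main term» is already a theorem on the twin face (Wu 1990: 1.015; arXiv:2405.05727 Thm 1.3:
1.2759 ≥ 1) and at 0.986 of 1 on the
Goldbach face (Thm 1.1: 1.9728·C(N) vs 2C(N), open by 1.4 %), the DILUTION η₀ = 1/2 of the Chen
weight, which is open on both faces
(needs Chen-type constant 2 in HL units) yet EH-accessible with a factor 2 to spare (Bombieri1976, k
= 2, plus Λ₂(p₁p₂) ≤ ½ log²(p₁p₂)). Imported: linear-sieve theory (BombieriDavenport1966,
HalberstamRichert1974, Lichtman2025LinearSieve),
Chen's switching (ChenSciSinica1973; tree Chen.Chen1973_theoremII_holds is the η = 3/2 rung),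
level-of-distribution results
(arXiv:2505.00653: 3/5 and 5/8). Versus prior routes: the record and G1.2 keep the constants as
rungs below costume leaves (FU is
⊠-closed so a UNIFORM constant dial collapses); no route has a dilution dial; lens-1's B1.1 (BH
side) dials degree/threshold at θ = 1,
which on the GHL side is a theorem (certified negative above).

RANKED CRUXES. #2 UpperParityLine (crux) — for all d,t,L ≥ 1 and ε > 0, eventually in N, uniformly
over non-degenerate systems Ψ of t affine-linear forms in d variables with ‖Ψ‖_N ≤ L and convex K ⊆
[−N,N]^d: Σ_(n∈K∩ℤ^d) ∏ᵢ Λ(ψᵢ(n)) ≤ 2^(t−1)·|β_∞·∏_p β_p| + εN^d (the parity-line upper envelope;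
WEAKER: kernel necessity, holds in every single-parity-bit world (λ = χ models saturate it: bias
exactly 2^(t−1)); ATTACKABLE = the pair face d = 1, t = 2, uniform in the shift incl. Goldbach:
twin/Goldbach counts ≤ (2+ε)·HL, records 3.2996 twins / 3.910 Goldbach, = 2 under EH (tree
TwinSieveLevel.twinSieveUpperBound_two_of_EH); full leaf = t ≥ 3 faces of infinite complexity
IDEA-NEEDED (sieve dimension ≥ 2: Selberg's upper sieve gives (t−1)!·(2/θ)^(t−1), i.e. 8 not 4 at t
= 3 even under GEH) — load-bearing for landing the leaf as ONE item). [difficulty: XL] (why it might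
fail: an intermediate-regime exceptional character (outside the Matomäki–Merikoski window) or a
genuinely multidimensional conspiracy could push some infinite-complexity system's bias above
2^(t−1); no model or theorem exhibits one, and single-parity-bit worlds cap at exactly 2^(t−1).)
[BombieriDavenport1966, HalberstamRichert1974, Lichtman2025LinearSieve, MatomakiMerikoski2023,
Greaves2001, arXiv:0709.3764, arXiv:2505.00653]
#3 LowerDilutedChen (crux) — for all d,t,L ≥ 1 and ε > 0, eventually in N, uniformly over
non-degenerate Ψ with ‖Ψ‖_N ≤ L and convex K ⊆ [−N,N]^d: β_∞·∏β_p − Σ_(n∈K∩ℤ^d) Λ(ψ₀(n))·∏_(i≥1) (Λ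
+ ½ρ_N)(ψᵢ(n)) ≤ εN^d, ρ_N(m) = log N·1[Ω(m) = 2] (the diluted Chen lower envelope at dilution 1/2;
WEAKER: kernel necessity since the diluted weight dominates Λ (vonMangoldtSum_le_dilutedSum);
ATTACKABLE = the pair face: twins + half the prime–semiprime pair mass reach the HL main term, i.e.
a Chen-type constant ≥ 2 in HL units — known 0.638 of the needed 1 on the twin face (½·1.2759,
arXiv:2405.05727 Thm 1.3) and 0.493 on the Goldbach face (½·0.986, Thm 1.1: 1.9728·C(N) vs HL
2C(N)); at the undiluted notch η = 1 the twin face is CERTIFIED (1.2759 ≥ 1) and the Goldbach face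
stands at 0.986 (open by 1.4 %) — hence the dilution; EH-accessible via Bombieri's asymptotic sieve
k = 2; full leaf = t ≥ 3 faces IDEA-NEEDED (asymptotic sieve in dimension > 1)). [difficulty: L]
(why it might fail: implied by GHL (kernel), so it fails only with GHL; the live risk is the
opposite — Chen-type constants reaching 2 in HL units (Li–Pascadi programme: 1.2759 twins, 0.986·2
Goldbach, rising) make the pair face a theorem and the node re-dials η₀ ↦ 1/4 (declared).)
[ChenSciSinica1973, Bombieri1976, arXiv:2405.05727, arXiv:2505.00653, HalberstamRichert1974]
#4 UpperParityLiftQ (crux) — DECLARED-RESIDUAL (residual: UpperParityLiftQ): UpperParityLine → (Q →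
UpperGHL), i.e. the parity-line upper envelope implies the record residual UQ = stmt-Parity-25149
(text inlined); content = the pure parity step 2^(t−1) → 1 on the upper side, Landau–Siegel content
discharged by Q; formally WEAKER than UQ (kernel liftU_of_UQ) and EXACT given the piece
(UQ_iff_liftU); zero distance credit; terminal notch (retires when UpperParityLine lands). [deps:
UpperParityLine] [difficulty: open-problem] (why it might fail: it fails exactly if some system sits
strictly between the parity line and HL at bounded Siegel quality — the Bombieri/Selberg
indeterminacy realised in the primes; every sieve-axiom model allows it, no arithmetic instance is
known.) [Bombieri1976, Selberg1949, Greaves2001, MatomakiMerikoski2023, GreenTao2010]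
#5 LowerDilutionLiftQ (crux) — DECLARED-RESIDUAL (residual: LowerDilutionLiftQ): LowerDilutedChen →
(Q → LowerGHL), i.e. the diluted lower envelope implies the record residual LQ = stmt-Parity-25150
(text inlined); content = parity at dilution 0⁺ (continuity at η = 0 of η ↦ liminf (prime pairs +
η·Chen mass)/HL), Landau–Siegel content discharged by Q; formally WEAKER than LQ (liftL_of_LQ),
EXACT given the piece (LQ_iff_liftL); zero distance credit; contraction rule η₀ ↦ η₀/2 when the
piece lands. [deps: LowerDilutedChen] [difficulty: open-problem] (why it might fail: it fails
exactly if prime tuples fall short of HL while diluted tuples do not, at bounded Siegel quality —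
the lower parity indeterminacy (Bombieri k = 1) realised in the primes; twin primes finitely many
would do it.) [Bombieri1976, Selberg1949, ChenSciSinica1973, GreenTao2010, MatomakiMerikoski2023]
#6 BoundedSiegelZeroQuality (crux) — the record leaf Q = stmt-Parity-25148 VERBATIM (ledger dedup
attaches this route to the shared item): exceptional zeros of primitive real characters have bounded
quality at all large conductors (¬UnboundedSiegelZeros); necessary for GHL modulo Matomäki–Merikoski
2023 (tree PairsToGHL.Negative.not_generalizedHardyLittlewood_of_unboundedSiegelZeros); already
split on the record route into HighBandZeroFree / LowBandZeroFree. [difficulty: open-problem] (why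
it might fail: Landau–Siegel: no zero-free region of the required quality is known; a sequence of
conductors with η → ∞ exceptional zeros is consistent with everything proved (Deuring–Heilbronn
phenomenon).) [MatomakiMerikoski2023, GreenTao2010]

TWO-LAYER PLAN. Foreseen (not filed): UpperParityLine ⇐ PairUpperLine (d = 1, t = 2, uniform in the
shift: the twin/Goldbach constant 2) → (PairUpperLine →
UpperParityLine) (fibration + vector sieve for t ≥ 3 / d ≥ 2); LowerDilutedChen ⇐ PairDilutedChen
(Chen's constant 2, every even shift,
Goldbach-uniform) → (PairDilutedChen → LowerDilutedChen). The lifts are never split (residuals);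
when UpperParityLine lands the upper lift
becomes UQ itself and is dropped (terminal notch); when LowerDilutedChen lands the node is re-opened
at dilution 1/4 (new items, not a resplit).

KILL CRITERIA. A refutation of UpperParityLine or LowerDilutedChen refutes GHL itself (kernel
necessity): route and sub-problem close refuted together. A proof
that UnboundedSiegelZeros refutes either envelope would contradict the saturation computations
(factor 2 at h = 2q is ON the line; factor 0 at
h = q/2 is compensated by the doubled semiprime mass) and would kill the
«exceptional-character-immune» claim: pivot = Q-condition that envelope.
A proof of UpperParityLine makes UpperParityLiftQ ≡ UQ (costume): the upper half of the route is
then superseded by the record (declared). A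
proof of LowerDilutedChen re-dials the lower half to η₀ = 1/4 (declared). A proof of GHL →
LowerDilutionLiftQ-free assembly (i.e. LQ from the
diluted envelope alone) would be a parity break and would close LQ.

NOT DECOMPOSED YET. The envelopes are not split by (d,t) or by shift range at open (critic traps
T2/T3/T9″: population cells of ⊠-closed statements are costume or
decoration; the pair faces are foreseen layer-2 children, see Two-layer plan). The dilution is a
fixed literal 1/2 (T11(d)); the EH line (≤ 1/4
by the Λ₂ comparison, possibly lower) is NOT claimed extremal. The t ≥ 3 / d ≥ 2 faces of both
envelopes (vector sieve × Green–Tao–Ziegler;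
asymptotic sieve in dimension > 1) are sub-content tagged IDEA-NEEDED, not items. No constant below
2^(t−1) and no dilution below the record
notch is filed (T10/T11).

CHEAPEST FALSIFIER. (i) Collapse test (T10): does UpperParityLine imply a uniform constant and hence
Q? No — C(t)^k ≤ C(kt) (kernel parityLineConst_tensorPower), the
tensor-power argument returns only k = 1. (ii) Theorem test (T8) on the lower envelope: is dilution
1/2 already proved? Known Chen constants give
0.638 (twins: ½·1.2759, arXiv:2405.05727 Thm 1.3) and 0.493 (Goldbach: ½·0.986, Thm 1.1 in HL units)
of the needed 1 — open on both faces; at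
dilution 1 the twin face IS a theorem (1.2759 ≥ 1; Goldbach face 0.986, open by 1.4 %) — this killed
the undiluted draft on its fixed-shift face
(trap T8; recorded as the cell's certified negative). (iii) Siegel test: MM2023 Thm 1.3 factors 2 (h
= 2q) and
0 (h = q/2, 4 ∣ q): 2 ≤ 2^(2−1) on the nose; 0·(primes) + ½·2·(semiprime mass ~ HL·loglog N) ≥ HL —
both envelopes survive USZ. (iv) Degeneracy:
t = 1 faces are Siegel–Walfisz-class theorems (C(1) = 1, no relaxed form) — decoration acknowledged,
content starts at t = 2.

NUMBERS. Upper pair constant (HL units): 4 (BombieriDavenport1966; tree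
TwinSieveFour.twinSieveUpperBound_four) → 3.9171 → 3.5 (BFI 1986) → 3.418 →
3.3996 (Wu 2004) → 3.2996 (Lichtman2025LinearSieve); Goldbach 7.8342 → 7.8209·C(N) (Wu 2004) vs HL
2C(N) [arXiv:0709.3764 p.1]; 2 under EH
(tree twinSieveUpperBound_two_of_EH). Chen constants (HL units): twins 0.335 (ChenSciSinica1973;
tree Chen1973_theoremII_holds has 0.67·𝔖(h)
in Chen's normalisation) → 1.015 (Wu 1990) → 1.13 (Cai 2008) → 1.238 → 1.2759 (arXiv:2405.05727 Thm
1.3); Goldbach 0.67 → 0.899 (Wu 2008) →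
1.733 → 1.9728 (Thm 1.1). In HL units (twin HL = C₂x/log²x, Goldbach HL = 2C(N)N/log²N): η = 1 needs
1 (have 1.2759 twins ✓ theorem; 0.986 Goldbach, open);
η₀ = 1/2 needs 2 (have 1.2759 twins; 0.986 Goldbach, i.e. D_(1,2)(N) ≥ 4C(N)N/log²N needed vs 1.9728
known). Levels of distribution: 1/2 (BV) → 4/7 (BFI,
well-factorable) → 3/5 (Maynard 2025; arXiv:2505.00653 Thm 1.2(ii)) → 5/8 (arXiv:2505.00653 Thm
1.2(i), triply well-factorable) → 1 (EH).

DEFINITION REQUESTS. None: all pieces are stated over existing declarations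
(Literature.NumberTheory.Sieve.{AffLinForm, IsNondegenerateSystem, affLinSize, realBox,
vonMangoldtSum, archFactor, singularProduct, latticeBox, realPoint, intVonMangoldt},
ArithmeticFunction.cardFactors, Set.indicator,
Literature.Barriers.Parity.IsSiegelZero).

Novelty: Searches (2026-08-30): lean search 'ParityLine|parityLine|dilut|Diluted' (no tree decls); the 27
Parity/GHL Theses of the cell census + TREE v4 (SiegelSpectrumSplit, SiegelBandSplit,
TupleUniformitySplit, TelescopingWindows, ShiftTauberian, ClusterGapCarving, OneSidedDegreeLadder,
OneSidedAggregateExchangeRate …: constants appear only as rungs; no dilution); lit search --hybrid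
"upper bound twin primes constant sieve Bombieri Davenport 4 3.5 Wu" (hits: arXiv:0709.3764 p.1
history; book:finch2003 p.100 via lens-5); lit search --hybrid "Chen theorem constant improvement P2
twin" (arXiv:2405.05727 pp.2–3: full history 0.335 → 1.2759, Goldbach 0.67 → 1.9728); lit search
"Pascadi exponents of distribution" (arXiv:2505.00653); lit galaxy search "parity line|diluted sieve
weight" --star all (0 relevant); negatives index Parity (no constant- or dilution-type statement
refuted).
Nearest prior art found: Bombieri1976 (asymptotic sieve: level 1 decides Λ_k, k ≥ 2, and leaves
exactly the parity bit) and Greaves2001 Thm 4.5.1 (F(s) = 2e^γ/s attained) — together they DEFINE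
the line this node cuts along; on the hub: SiegelSpectrumSplit / TupleUniformitySplit (constants as
rungs of costume leaves), OneSidedDegreeLadder (BH-side θ/e dials).
Delta: the first GHL decomposition whose attackable leaves are the Type-I-accessible ENVELOPES of
the two halves as load-bearing binders — made possible by the ⊠-stable saturation law 2^(t−1)
(upper) and by the dilution dial η interpolating the parity-har  [refs: 0709.3764, 2405.05727, 2505.00653, book:finch2003, Bombieri1976, Greaves2001]

Barriers (technique_class: decomposition, sieve-envelope, parity-line): - technique_class: decomposition, sieve-envelope, parity-line
- Literature.Barriers.Parity.LinearSieveOptimality: UpperParityLine sits EXACTLY at the barrier's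
constant (F → 2 per sifted prime condition): outside its kill zone by construction — closing it
needs level of distribution (θ → 1 or Lichtman-type modifications), not a parity break;
UpperParityLiftQ (2 → 1) is INSIDE head-on, declared residual.
- Literature.Barriers.Parity.SelbergParityBarrier: LowerDilutedChen is outside (a lower bound for a
NON-prime-supported weight: Selberg's 𝒜⁻ example has full diluted mass); LowerDilutionLiftQ is
inside head-on (lower bound for the prime mass), declared residual.
- Literature.Barriers.Parity.PrimePairParity: same placement as SelbergParityBarrier for the lower
pair; the upper pair is not a lower-bound statement.
- Literature.Barriers.Parity.SiegelZeroPrimePairBarrier: both envelopes OUTSIDE (saturated, not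
refuted: factor 2 at h = 2q is on the upper line; factor 0 at h = q/2 is compensated in the diluted
sum); both lifts carry Q, so the barrier is discharged by conditioning exactly as on the record
route.
- Literature.Barriers.Parity.SiegelZeroTwinPrimes: consistent — kernel necessity of every piece from
GHL means USZ refutes a piece only where it refutes GHL; the envelopes are the pieces it does not
reach.
- Literature.Barriers.Parity.BrunTitchmarshSiegelZero: consistent — only a UNIFORM upper constant <
2 would exclude Siegel zeros; the law 2^(t−1) never goes below 2 on a pai

History (route lifecycle, newest last):
- 2026-08-30T04:44:43Z · rev 2: informal re-worded for LowerDilutedChen (planner-decomp-parity-lens-6-g3-0)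
- 2026-09-04T14:29:50Z · DORMANT — reconciler: no traction for 5 d (last activity statement-checked at 2026-08-30T13:44:23Z); parked, not closed — `ledger route dormant route-Parity-ParityLineCar (operator:999:1010722)

sub-problem: GeneralizedHardyLittlewood · status: dormant · opened planner-decomp-parity-lens-6-g3-0 2026-08-30T04:33:58Z · rev 3 · ledger route-Parity-ParityLineCarving
GENERATED by the gate from the ledger (D-0016/17). Provers cite these decls: `theorem foo : Summit.Parity.GeneralizedHardyLittlewood.Theses.ParityLineCarving.<Decl> := …` in Summits/Parity/GeneralizedHardyLittlewood/Theorems/<Name>.lean.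
-/

namespace Summit.Parity.GeneralizedHardyLittlewood.Theses.ParityLineCarving

open scoped BigOperators Topology Manifold Classical MeasureTheory ProbabilityTheory Matrix InnerProductSpace ComplexConjugate ContinuousMap
open Filter Set Function TopologicalSpace MeasureTheory

attribute [summit_statement] _root_.GeneralizedHardyLittlewood

/-- item stmt-Parity-27816 · crux · rank 2 · open · by planner
why it might fail: an intermediate-regime exceptional character (outside the Matomäki–Merikoski window) or a genuinely multidimensional conspiracy could push some infinite-complexity system's bias above 2^(t−1); no model or theorem exhibits one, and single-parity-bit worlds cap at exactly 2^(t−1).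
sources: BombieriDavenport1966, HalberstamRichert1974, Lichtman2025LinearSieve, MatomakiMerikoski2023, Greaves2001, arXiv:0709.3764
[crux] for all d,t,L ≥ 1 and ε > 0, eventually in N, uniformly over non-degenerate systems Ψ of t
affine-linear forms in d variables with ‖Ψ‖_N ≤ L and convex K ⊆ [−N,N]^d: Σ_(n∈K∩ℤ^d) ∏ᵢ Λ(ψᵢ(n)) ≤
2^(t−1)·|β_∞·∏_p β_p| + εN^d (the parity-line upper envelope; WEAKER: kernel necessity, holds in
every single-parity-bit world (λ = χ models saturate it: bias exactly 2^(t−1)); ATTACKABLE = the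
pair face d = 1, t = 2, uniform in the shift incl. Goldbach: twin/Goldbach counts ≤ (2+ε)·HL,
records 3.2996 twins / 3.910 Goldbach, = 2 under EH (tree
TwinSieveLevel.twinSieveUpperBound_two_of_EH); full leaf = t ≥ 3 faces of infinite complexity
IDEA-NEEDED (sieve dimension ≥ 2: Selberg's upper sieve gives (t−1)!·(2/θ)^(t−1), i.e. 8 not 4 at t
= 3 even under GEH) — load-bearing for landing the leaf as ONE item). [difficulty: XL] -/
@[route_item "route-Parity-ParityLineCarving"]
def UpperParityLine : Prop :=
  ∀ (d t L : ℕ), 1 ≤ d → 1 ≤ t → ∀ ε : ℝ, 0 < ε → ∃ N₀ : ℕ, ∀ N : ℕ, N₀ ≤ N → ∀ Ψ : Fin t → Literature.NumberTheory.Sieve.AffLinForm d, Literature.NumberTheory.Sieve.IsNondegenerateSystem Ψ → Literature.NumberTheory.Sieve.affLinSize Ψ N ≤ L → ∀ K : Set (Fin d → ℝ), Convex ℝ K → K ⊆ Literature.NumberTheory.Sieve.realBox d N → Literature.NumberTheory.Sieve.vonMangoldtSum Ψ K N ≤ (2 : ℝ) ^ (t - 1) * |Literature.NumberTheory.Sieve.archFactor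 Ψ K * Literature.NumberTheory.Sieve.singularProduct Ψ| + ε * (N : ℝ) ^ d

/-- item stmt-Parity-27817 · crux · rank 3 · open · by planner
why it might fail: Kernel-implied by GHL, so false only with GHL; live risk = already-a-theorem: pair face certified for η ≥ η_BV = 1/(4(1−c₂(½))) via Bombieri's BV-level Λ₂ sieve [Bo1]; literal η₀=½ PROVISIONAL (beyond print iff c₂(½)>½; acq-14852), re-dial into (¼,η_BV) on arrival.
sources: ChenSciSinica1973, Bombieri1975, Bombieri1976, arXiv:math/0401215, book:broughannd-bounded-gaps-between-primes, arXiv:2405.05727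
for all d,t,L ≥ 1 and ε > 0, eventually in N, uniformly over non-degenerate Ψ with ‖Ψ‖_N ≤ L and
convex K ⊆ [−N,N]^d: β_∞·∏β_p − Σ_(n∈K∩ℤ^d) Λ(ψ₀(n))·∏_(i≥1) (Λ + ½ρ_N)(ψᵢ(n)) ≤ εN^d, ρ_N(m) = log
N·1[Ω(m) = 2] (the diluted Chen lower envelope at dilution 1/2; WEAKER: kernel necessity since the
diluted weight dominates Λ (vonMangoldtSum_le_dilutedSum); ATTACKABLE = the pair face: twins + half
the prime–semiprime pair mass reach the HL main term, i.e. a Chen-type constant ≥ 2 in HL units —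
known 0.638 of the needed 1 on the twin face (½·1.2759, arXiv:2405.05727 Thm 1.3) and 0.493 on the
Goldbach face (½·0.986, Thm 1.1: 1.9728·C(N) vs HL 2C(N)); at the undiluted notch η = 1 the twin
face is CERTIFIED (1.2759 ≥ 1) and the Goldbach face stands at 0.986 (open by 1.4 %) — hence the
dilution; EH-accessible via Bombieri's asymptotic sieve k = 2; full leaf = t ≥ 3 faces IDEA-NEEDED
(asymptotic sieve in dimension > 1)). RECORD / PROVISIONAL (decomp-parity critic l.142 hold): since
Λ₂(p₁p₂) ≤ ½·log²(p₁p₂), Bombieri's BV-level k = 2 asymptotic-sieve bound S₂ ≥ 2(1 − c₂(½))·(HL main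
term) [Bo1: Bombieri, «On twin almost primes», Acta Arith. 28 (1975) 177–193 + corrigendum 28 (1976)
457–461; acq -/
@[route_item "route-Parity-ParityLineCarving"]
def LowerDilutedChen : Prop :=
  ∀ (d t L : ℕ), 1 ≤ d → 1 ≤ t → ∀ ε : ℝ, 0 < ε → ∃ N₀ : ℕ, ∀ N : ℕ, N₀ ≤ N → ∀ Ψ : Fin t → Literature.NumberTheory.Sieve.AffLinForm d, Literature.NumberTheory.Sieve.IsNondegenerateSystem Ψ → Literature.NumberTheory.Sieve.affLinSize Ψ N ≤ L → ∀ K : Set (Fin d → ℝ), Convex ℝ K → K ⊆ Literature.NumberTheory.Sieve.realBox d N → Literature.NumberTheory.Sieve.archFactor Ψ K * Literature.NumberTheory.Sieve.singularProduct Ψ - (∑ n ∈ Literature.NumberTheory.Sieve.latticeBox d N, K.indicator (fun _ => (1 : ℝ)) (Literature.NumberTheory.Sieve.realPoint n) * ∏ i : Fin t, (Literature.NumberTheory.Sieve.intVonMangoldt ((Ψ i).eval n) + (if (i : ℕ) = 0 then (0 : ℝ) else (1 / 2 : ℝ) * (if ArithmeticFunction.cardFactors (((Ψ i).eval n).toNat)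 = 2 then Real.log (N : ℝ) else 0)))) ≤ ε * (N : ℝ) ^ d

/-- item stmt-Parity-27818 · crux · rank 4 · open · by planner
why it might fail: it fails exactly if some system sits strictly between the parity line and HL at bounded Siegel quality — the Bombieri/Selberg indeterminacy realised in the primes; every sieve-axiom model allows it, no arithmetic instance is known.
sources: Bombieri1976, Selberg1949, Greaves2001, MatomakiMerikoski2023, GreenTao2010
[crux] DECLARED-RESIDUAL (residual: UpperParityLiftQ): UpperParityLine → (Q → UpperGHL), i.e. the
parity-line upper envelope implies the record residual UQ = stmt-Parity-25149 (text inlined);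
content = the pure parity step 2^(t−1) → 1 on the upper side, Landau–Siegel content discharged by Q;
formally WEAKER than UQ (kernel liftU_of_UQ) and EXACT given the piece (UQ_iff_liftU); zero distance
credit; terminal notch (retires when UpperParityLine lands). [deps: UpperParityLine] [difficulty:
open-problem] -/
@[route_item "route-Parity-ParityLineCarving"]
def UpperParityLiftQ : Prop :=
  (∀ (d t L : ℕ), 1 ≤ d → 1 ≤ t → ∀ ε : ℝ, 0 < ε → ∃ N₀ : ℕ, ∀ N : ℕ, N₀ ≤ N → ∀ Ψ : Fin t → Literature.NumberTheory.Sieve.AffLinForm d, Literature.NumberTheory.Sieve.IsNondegenerateSystem Ψ → Literature.NumberTheory.Sieve.affLinSize Ψ N ≤ L → ∀ K : Set (Fin d → ℝ), Convex ℝ K → K ⊆ Literature.NumberTheory.Sieve.realBox d N → Literature.NumberTheory.Sieve.vonMangoldtSum Ψ K N ≤ (2 : ℝ) ^ (t - 1) * |Literature.NumberTheory.Sieve.archFactor Ψ K * Literature.NumberTheory.Sieve.singularProduct Ψ| + ε * (N : ℝ) ^ d) → (∃ η₀ : ℝ, ∃ q₀ : ℕ, ∀ (q : ℕ) [NeZero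 q] (χ : DirichletCharacter ℂ q) (η : ℝ), q₀ ≤ q → Literature.Barriers.Parity.IsSiegelZero χ η → η < η₀) → ∀ (d t L : ℕ), 1 ≤ d → 1 ≤ t → ∀ ε : ℝ, 0 < ε → ∃ N₀ : ℕ, ∀ N : ℕ, N₀ ≤ N → ∀ Ψ : Fin t → Literature.NumberTheory.Sieve.AffLinForm d, Literature.NumberTheory.Sieve.IsNondegenerateSystem Ψ → Literature.NumberTheory.Sieve.affLinSize Ψ N ≤ L → ∀ K : Set (Fin d → ℝ), Convex ℝ K → K ⊆ Literature.NumberTheory.Sieve.realBox d N → Literature.NumberTheory.Sieve.vonMangoldtSum Ψ K N - Literature.NumberTheory.Sieve.archFactor Ψ K * Literature.NumberTheory.Sieve.singularProduct Ψ ≤ ε * (N : ℝ) ^ d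

/-- item stmt-Parity-27819 · crux · rank 5 · open · by planner
why it might fail: it fails exactly if prime tuples fall short of HL while diluted tuples do not, at bounded Siegel quality — the lower parity indeterminacy (Bombieri k = 1) realised in the primes; twin primes finitely many would do it.
sources: Bombieri1976, Selberg1949, ChenSciSinica1973, GreenTao2010, MatomakiMerikoski2023
[crux] DECLARED-RESIDUAL (residual: LowerDilutionLiftQ): LowerDilutedChen → (Q → LowerGHL), i.e. the
diluted lower envelope implies the record residual LQ = stmt-Parity-25150 (text inlined); content =
parity at dilution 0⁺ (continuity at η = 0 of η ↦ liminf (prime pairs + η·Chen mass)/HL),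
Landau–Siegel content discharged by Q; formally WEAKER than LQ (liftL_of_LQ), EXACT given the piece
(LQ_iff_liftL); zero distance credit; contraction rule η₀ ↦ η₀/2 when the piece lands. [deps:
LowerDilutedChen] [difficulty: open-problem] -/
@[route_item "route-Parity-ParityLineCarving"]
def LowerDilutionLiftQ : Prop :=
  (∀ (d t L : ℕ), 1 ≤ d → 1 ≤ t → ∀ ε : ℝ, 0 < ε → ∃ N₀ : ℕ, ∀ N : ℕ, N₀ ≤ N → ∀ Ψ : Fin t → Literature.NumberTheory.Sieve.AffLinForm d, Literature.NumberTheory.Sieve.IsNondegenerateSystem Ψ → Literature.NumberTheory.Sieve.affLinSize Ψ N ≤ L → ∀ K : Set (Fin d → ℝ), Convex ℝ K → K ⊆ Literature.NumberTheory.Sieve.realBox d N → Literature.NumberTheory.Sieve.archFactor Ψ K * Literature.NumberTheory.Sieve.singularProduct Ψ - (∑ n ∈ Literature.NumberTheory.Sieve.latticeBox d N, K.indicator (fun _ => (1 : ℝ)) (Literature.NumberTheory.Sieve.realPoint n) * ∏ i : Fin t, (Literature.NumberTheory.Sieve.intVonMangoldt ((Ψ i).eval n) + (if (i : ℕ) =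 0 then (0 : ℝ) else (1 / 2 : ℝ) * (if ArithmeticFunction.cardFactors (((Ψ i).eval n).toNat) = 2 then Real.log (N : ℝ) else 0)))) ≤ ε * (N : ℝ) ^ d) → (∃ η₀ : ℝ, ∃ q₀ : ℕ, ∀ (q : ℕ) [NeZero q] (χ : DirichletCharacter ℂ q) (η : ℝ), q₀ ≤ q → Literature.Barriers.Parity.IsSiegelZero χ η → η < η₀) → ∀ (d t L : ℕ), 1 ≤ d → 1 ≤ t → ∀ ε : ℝ, 0 < ε → ∃ N₀ : ℕ, ∀ N : ℕ, N₀ ≤ N → ∀ Ψ : Fin t → Literature.NumberTheory.Sieve.AffLinForm d, Literature.NumberTheory.Sieve.IsNondegenerateSystem Ψ → Literature.NumberTheory.Sieve.affLinSize Ψ N ≤ L → ∀ K : Set (Fin d → ℝ), Convex ℝ K → K ⊆ Literature.NumberTheory.Sieve.realBox d N → Literature.NumberTheory.Sieve.archFactor Ψ K * Literature.NumberTheory.Sieve.singularProduct Ψ - Literature.NumberTheory.Sieve.vonMangoldtSum Ψ K N ≤ ε * (N : ℝ) ^ d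

/-- item stmt-Parity-25148 · crux · rank 6 · open · by planner
why it might fail: Landau–Siegel: no zero-free region of the required quality is known; a sequence of conductors with η → ∞ exceptional zeros is consistent with everything proved (Deuring–Heilbronn phenomenon).
sources: MatomakiMerikoski2023, GreenTao2010
[crux] Siegel zeros of primitive quadratic characters have bounded quality at all large conductors:
∃ η₀ q₀, every Siegel zero (IsSiegelZero χ η) of conductor q ≥ q₀ has η < η₀ — literally
¬UnboundedSiegelZeros (Landau–Siegel in the form the MM bridge needs). [difficulty: open-problem] ‖
TAG [crit-1 CLEARED 2026-08-30T01:46:27Z, HOME/STATUS.md l.26]: WEAKER (kernel mod MM2023 print; Q ⟹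
GHL unknown); leaf IDEA-NEEDED (Landau–Siegel) + ATTACKABLE-rung (Zhang2022 skeleton routes
PrimeLevelFamEdge/ZDegreeToeplitzBand; lens-2 T_ω ladder) + INSTRUMENTABLE (finite conductor tables,
not a rung). BC3 birth skeleton: stub_weakGoldbach (WeakHLGoldbachConj ½, open) → stub_exclusion
(MM2023 Cor 1.2 Goldbach detector + |L'| ≪ log²q, provable-now) → Q. Census
HOME/census/COSTUME-CENSUS-v1.md sha256
4afbbbc68c038369818dcc2bcc5990569ac50a4757d8938468c0838377ddd628 row WK8. -/
@[route_item "route-Parity-ParityLineCarving"]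
def BoundedSiegelZeroQuality : Prop :=
  ∃ η₀ : ℝ, ∃ q₀ : ℕ, ∀ (q : ℕ) [NeZero q] (χ : DirichletCharacter ℂ q) (η : ℝ), q₀ ≤ q → Literature.Barriers.Parity.IsSiegelZero χ η → η < η₀

/-- item stmt-Parity-27820 · assembly · rank 1 · closed · proved by Summit.Parity.GeneralizedHardyLittlewood.Theses.ParityLineCarving.assembly_proof (prover) · by planner
sources: GreenTao2010, Bombieri1976
[assembly] BoundedSiegelZeroQuality → UpperParityLine → UpperParityLiftQ → LowerDilutedChen →
LowerDilutionLiftQ → GeneralizedHardyLittlewood -/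
@[route_item "route-Parity-ParityLineCarving"]
def Assembly : Prop :=
  BoundedSiegelZeroQuality → UpperParityLine → UpperParityLiftQ → LowerDilutedChen → LowerDilutionLiftQ → GeneralizedHardyLittlewood

-- `Assembly` holds: proved by `Summit.Parity.GeneralizedHardyLittlewood.Theses.ParityLineCarving.assembly_proof` (its module imports this route file, so no `_holds` link can be stated here).

/-! D-0027 §2.1 — DECIDING THEOREM (planner-authored via `route open/edit --closes-file`; by planner-decomp-parity-lens-6-g3-0 2026-08-30T04:33:58Z):
its hypotheses are this route's items and its conclusion the sub-problem Statement (glue_lint), and it elaborates with this file. -/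

@[closes "route-Parity-ParityLineCarving"] theorem closes (hQ : BoundedSiegelZeroQuality) (hAu : UpperParityLine) (hLu : UpperParityLiftQ)
    (hAl : LowerDilutedChen) (hLl : LowerDilutionLiftQ) : GeneralizedHardyLittlewood := by
  intro d t L hd ht ε hε
  obtain ⟨N₁, h₁⟩ := hLu hAu hQ d t L hd ht ε hε
  obtain ⟨N₂, h₂⟩ := hLl hAl hQ d t L hd ht ε hε
  refine ⟨max N₁ N₂, fun N hN Ψ hΨ hΨL K hK hKN => abs_sub_le_iff.mpr ⟨?_, ?_⟩⟩
  · exact h₁ N (le_trans (le_max_left _ _) hN) Ψ hΨ hΨL K hK hKN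
  · exact h₂ N (le_trans (le_max_right _ _) hN) Ψ hΨ hΨL K hK hKN

end Summit.Parity.GeneralizedHardyLittlewood.Theses.ParityLineCarving
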